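import Summits.MatrixMultiplication.MatrixMultiplication.Theorems.SoloBlindDegenerationRealization
import Mathlib.Algebra.Polynomial.Expand
import HarnessLib

/-!
# Toric (monomial) degenerations do not increase border rank

`Summit.MatrixMultiplication.MatrixMultiplication.Theorems` — solo programme `solo-MatrixMultiplication-blind`.

The degeneration rung `algBorderRank_initialPart_le_tensorRank` (landed) bounds the border rank of a
toric initial part `in_h t = [w₁ a + w₂ b + w₃ c = h] · t` by the **rank** of `t`.  Here we prove the
sharper and fully composable statement: it is bounded by the **border rank** of `t`,

  `bR(in_h t) ≤ bR(t)`   whenever `t` vanishes in total weight `< h`,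

by substituting `ε ↦ ε^{h+1}` in an approximate decomposition of `t` (Mathlib's `Polynomial.expand`)
and multiplying the three factor vectors by `ε^{w₁ a}, ε^{w₂ b}, ε^{w₃ c}`: the result is an approximate
decomposition of `in_h t` of order `(h+1)·h₀ + h` with the same number of triads.  Combined with
monotonicity under restriction (`TensorRestrictsTo.algBorderRank_le`) this is the certificate schema
"`T ≤ s` and `T_k = in_h T` ⟹ `bR(T_k) ≤ bR(s)`" used for monomial-algebra (staircase) sources `s`,
whose border rank is known but whose rank is larger.
-/

open scoped BigOperators Polynomial

open Literature.Computability.AlgebraicComplexity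

set_option linter.dupNamespace false

namespace Summit.MatrixMultiplication.MatrixMultiplication.Theorems

/-- **Toric twist of an approximate decomposition.** From `∑ u⊗v⊗w = ε^{h₀} t + O(ε^{h₀+1})` and weights
with `t = 0` in total weight `< h`: substituting `ε ↦ ε^{h+1}` and scaling the factors by `ε^{wᵢ}` gives
`∑ U⊗V⊗W = ε^{(h+1)h₀+h} in_h t + O(ε^{(h+1)h₀+h+1})`. [new] -/
theorem IsApproxDecomposition.toric {ι κ μ : Type*} {K : Type*} [CommRing K] {t : ι → κ → μ → K}
    {r h₀ : ℕ} {u : Fin r → ι → K[X]} {v : Fin r → κ → K[X]} {w : Fin r → μ → K[X]}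
    (huvw : IsApproxDecomposition h₀ t u v w) (w₁ : ι → ℕ) (w₂ : κ → ℕ) (w₃ : μ → ℕ) (h : ℕ)
    (hlow : ∀ a b c, w₁ a + w₂ b + w₃ c < h → t a b c = 0) :
    IsApproxDecomposition ((h + 1) * h₀ + h) (fun a b c => if w₁ a + w₂ b + w₃ c = h then t a b c else 0)
      (fun ρ a => Polynomial.X ^ (w₁ a) * Polynomial.expand K (h + 1) (u ρ a))
      (fun ρ b => Polynomial.X ^ (w₂ b) * Polynomial.expand K (h + 1) (v ρ b))
      (fun ρ c => Polynomial.X ^ (w₃ c) * Polynomial.expand K (h + 1) (w ρ c)) := by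
  intro a b c j hj
  dsimp only
  have hsum : (∑ ρ, Polynomial.X ^ (w₁ a) * Polynomial.expand K (h + 1) (u ρ a) *
      (Polynomial.X ^ (w₂ b) * Polynomial.expand K (h + 1) (v ρ b)) *
        (Polynomial.X ^ (w₃ c) * Polynomial.expand K (h + 1) (w ρ c))) =
      Polynomial.X ^ (w₁ a + w₂ b + w₃ c) *
        Polynomial.expand K (h + 1) (∑ ρ, u ρ a * v ρ b * w ρ c) := by
    rw [map_sum, Finset.mul_sum]
    refine Finset.sum_congr rfl fun ρ _ => ?_
    simp only [map_mul, pow_add]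
    ring
  rw [hsum, Polynomial.coeff_X_pow_mul']
  have hMpos : 0 < h + 1 := Nat.succ_pos h
  by_cases hle : w₁ a + w₂ b + w₃ c ≤ j
  · obtain ⟨d, hd⟩ : ∃ d, j = w₁ a + w₂ b + w₃ c + d := ⟨j - (w₁ a + w₂ b + w₃ c), by omega⟩
    have hsub : j - (w₁ a + w₂ b + w₃ c) = d := by omega
    rw [if_pos hle, hsub, Polynomial.coeff_expand hMpos]
    by_cases hdvd : (h + 1) ∣ d
    · obtain ⟨i, rfl⟩ := hdvd
      rw [if_pos (dvd_mul_right _ _), Nat.mul_div_cancel_left i hMpos]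
      have hi_le : i ≤ h₀ := by
        by_contra hcon
        have h1 : (h + 1) * (h₀ + 1) ≤ (h + 1) * i := Nat.mul_le_mul_left (h + 1) (by omega)
        rw [Nat.mul_succ] at h1
        omega
      by_cases hih : i = h₀
      · subst hih
        rw [huvw a b c i le_rfl, if_pos rfl]
        by_cases hwth : w₁ a + w₂ b + w₃ c = h
        · have hj' : j = (h + 1) * i + h := by omega
          rw [if_pos hj', if_pos hwth]
        · have hlt : w₁ a + w₂ b + w₃ c < h := by omega
          rw [hlow a b c hlt]
          split_ifs <;> rfl
      · rw [huvw a b c i hi_le, if_neg hih]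
        split_ifs with hj' hwth
        · exfalso
          apply hih
          have hmul : (h + 1) * i = (h + 1) * h₀ := by omega
          exact Nat.eq_of_mul_eq_mul_left hMpos hmul
        · rfl
        · rfl
    · rw [if_neg hdvd]
      split_ifs with hj' hwth
      · exact absurd ⟨h₀, by omega⟩ hdvd
      · rfl
      · rfl
  · rw [if_neg hle]
    split_ifs with hj' hwth
    · exfalso
      omega
    · rfl
    · rfl

/-- **Border rank is monotone under toric degeneration**: if `t` vanishes in total weight `< h` then
`bR(in_h t) ≤ bR(t)` for the initial part `in_h t = [w₁ a + w₂ b + w₃ c = h]·t`.  (Sharpens the landed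
`algBorderRank_initialPart_le_tensorRank`, which has `R(t)` on the right.) [new] -/
theorem algBorderRank_initialPart_le_algBorderRank {ι κ μ : Type} [Fintype ι] [Fintype κ] [Fintype μ]
    [DecidableEq ι] [DecidableEq κ] [DecidableEq μ] {K : Type*} [CommRing K] (t : ι → κ → μ → K)
    (w₁ : ι → ℕ) (w₂ : κ → ℕ) (w₃ : μ → ℕ) (h : ℕ) (hlow : ∀ a b c, w₁ a + w₂ b + w₃ c < h → t a b c = 0) :
    algBorderRank (fun a b c => if w₁ a + w₂ b + w₃ c = h then t a b c else 0) ≤ algBorderRank t := by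
  obtain ⟨h₀, hh₀⟩ := exists_algBorderRank_eq_approxRank t
  obtain ⟨u, v, w, huvw⟩ := exists_isApproxDecomposition_approxRank h₀ t
  rw [hh₀]
  exact (algBorderRank_le_approxRank _ _).trans
    (approxRank_le_of_isApproxDecomposition (IsApproxDecomposition.toric huvw w₁ w₂ w₃ h hlow))

/-- **Certificate schema (restriction + toric degeneration).** If `t` is a restriction of `s` and
`T = in_h t` is a toric initial part of `t` (with `t = 0` below weight `h`), then `bR(T) ≤ bR(s)`.
For `s` the structure tensor of a smoothable (e.g. monomial) algebra of dimension `m` one has `bR(s) = m`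
while `R(s)` is larger, so this is the form in which staircase certificates are consumed. [new] -/
theorem algBorderRank_initialPart_le_of_restrictsTo {ι κ μ ι' κ' μ' : Type} [Fintype ι] [Fintype κ]
    [Fintype μ] [DecidableEq ι] [DecidableEq κ] [DecidableEq μ] [Fintype ι'] [Fintype κ'] [Fintype μ']
    [DecidableEq ι'] [DecidableEq κ'] [DecidableEq μ'] {K : Type*} [CommRing K]
    (s : ι' → κ' → μ' → K) (t : ι → κ → μ → K) (hst : TensorRestrictsTo s t)
    (w₁ : ι → ℕ) (w₂ : κ → ℕ) (w₃ : μ → ℕ) (h : ℕ) (hlow : ∀ a b c, w₁ a + w₂ b + w₃ c < h → t a b c = 0) :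
    algBorderRank (fun a b c => if w₁ a + w₂ b + w₃ c = h then t a b c else 0) ≤ algBorderRank s :=
  (algBorderRank_initialPart_le_algBorderRank t w₁ w₂ w₃ h hlow).trans hst.algBorderRank_le

end Summit.MatrixMultiplication.MatrixMultiplication.Theorems
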